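import Summits.AtomisticToContinuum.HydrodynamicLimit.Theorems.CollisionIsometryCLTAdaptedWeightCLTBHCoarseningGermanoBounds

/-!
# Stub `stub_coarsening` (S6) of the line `block-h-dissipation-closure` for the crux `AdaptedWeightCLT`
(stmt-AtomisticToContinuum-14868, rev-12 TIME-LOCAL form; `--supports`), helper file: THE POINTWISE GERMANO
INEQUALITY for the crux integrand and sup bounds over one block

Summing the squared Germano split (`Coarsening.blkC_sq_le`) over the nine traceless stress tests `C2 j k`
(`|p| ≤ 2|y|²`, `|p(y+d) − p(y)| ≤ 4|y||d| + 2|d||d|`) and the three heat-flux tests `C3 a` (`|p| ≤ |y|³`,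
`|p(y+d) − p(y)| ≤ 6|y|²|d| + 3|d||d|²`) gives, for EVERY configuration `w` and block centre `x`
(`defectC_le_germano`):

  `defectC φ w x ≤ 4 ∫ φ_N(x' − x) defectC ψ w x' dx'`                                  (block average of CELL defects)
  `  + 144 ε_N² (N+1)⁻¹ Σᵢ 𝟙[d(xᵢ,x) < R_N] (∫ ψ_N(xᵢ−x')|vᵢ−ū_ψ(x')|⁴ dx' + ∫ ψ_N(xᵢ−x')|vᵢ−ū_ψ(x')|⁶ dx')`  (KERNEL VARIATION)
  `  + 1260 · ethG · reyG`                                                              (SUB-BLOCK REYNOLDS, `9·80 + 3·180`).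

Also: sup bounds of `blkC`, `defectC`, `ethG`, `reyG` over one block in terms of a velocity bound and the kernel
height (`abs_blkC_le`, `defectC_le_of_vel`, `ethG_le_of_vel`, `reyG_le_of_vel`), used along good orbits.
-/

namespace Summit.AtomisticToContinuum.HydrodynamicLimit.Theorems.BlockHDissipation

open scoped BigOperators Topology Classical MeasureTheory ENNReal InnerProductSpace
open Filter Set MeasureTheory
open Literature.Analysis.FluidPDE Literature.Analysis.FluidPDE.Torus
open Summit.AtomisticToContinuum.HydrodynamicLimit.Theorems.ContactSourceDuhamel
open Summit.AtomisticToContinuum.HydrodynamicLimit.Theorems.ContactSourceDuhamel.TimeLocal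
open Summit.AtomisticToContinuum.HydrodynamicLimit.Theorems.ContactBalance
open Summit.AtomisticToContinuum.HydrodynamicLimit.Theorems.SustainedAnisotropy
open Literature.MathematicalPhysics.KineticTheory (hsDiameter localGibbsLaw empiricalDensityField
  empiricalMomentumField)

noncomputable section

namespace Coarsening

/-! ## The two channels -/

/-- Test data of the STRESS channel: `|⟨C2 j k, y⊗y⟩| ≤ 2|y|²` and
`|⟨C2 j k, (y+d)^{⊗2}⟩ − ⟨C2 j k, y^{⊗2}⟩| ≤ 4 |y||d| + 2 |d||d|`. -/
theorem rank2_data (j k : Fin 3) :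
    (∀ y : V3, |pairT (C2 j k) (tpow 2 y)| ≤ 2 * ‖y‖ ^ 2) ∧
    (∀ y d : V3, |pairT (C2 j k) (tpow 2 (y + d)) - pairT (C2 j k) (tpow 2 y)| ≤
      4 * (‖y‖ * ‖d‖) + 2 * (‖d‖ * ‖d‖)) := by
  refine ⟨Pointwise.abs_pairT_C2_le j k, fun y d => ?_⟩
  have h := Pointwise.abs_pairT_C2_sub_le j k y (y + d)
  rw [add_sub_cancel_left] at h
  have hn : ‖y + d‖ ≤ ‖y‖ + ‖d‖ := norm_add_le _ _
  nlinarith [norm_nonneg y, norm_nonneg d]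

/-- Test data of the HEAT-FLUX channel: `|⟨C3 a, y^{⊗3}⟩| ≤ |y|³` and
`|⟨C3 a, (y+d)^{⊗3}⟩ − ⟨C3 a, y^{⊗3}⟩| ≤ 6 |y|²|d| + 3 |d||d|²`. -/
theorem rank3_data (a : Fin 3) :
    (∀ y : V3, |pairT (C3 a) (tpow 3 y)| ≤ 1 * ‖y‖ ^ 3) ∧
    (∀ y d : V3, |pairT (C3 a) (tpow 3 (y + d)) - pairT (C3 a) (tpow 3 y)| ≤
      6 * (‖y‖ ^ 2 * ‖d‖) + 3 * (‖d‖ * ‖d‖ ^ 2)) := by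
  refine ⟨fun y => (Pointwise.abs_pairT_C3_le a y).trans_eq (one_mul _).symm, fun y d => ?_⟩
  have h := Pointwise.abs_pairT_C3_sub_le a y (y + d)
  rw [add_sub_cancel_left] at h
  refine h.trans ?_
  have hn : ‖y + d‖ + ‖y‖ ≤ 2 * ‖y‖ + ‖d‖ := by linarith [norm_add_le y d]
  have h2 : (‖y + d‖ + ‖y‖) ^ 2 ≤ (2 * ‖y‖ + ‖d‖) ^ 2 := pow_le_pow_left₀ (by positivity) hn 2
  have h3 := mul_le_mul_of_nonneg_left h2 (norm_nonneg d)
  nlinarith [mul_nonneg (norm_nonneg d) (sq_nonneg (‖y‖ - ‖d‖)), norm_nonneg y, norm_nonneg d]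

section Pointwise

variable {N : ℕ} {γ C γc C' : ℝ} {φ ψ : ℕ → T3 → ℝ}

/-- Stress entries: `D_jk² ≤ 4 A_jk + 16 ε² KV₄ + 80 ethG·reyG`. -/
theorem blkC2_sq_le (hadm : AdmissibleKernel γ C φ) (hadmc : AdmissibleKernel γc C' ψ) (w : Cfg N) (x : T3)
    (j k : Fin 3) :
    blkC 2 N φ w x (C2 j k) ^ 2 ≤ 4 * (∫ x', φ N (x' - x) * blkC 2 N ψ w x' (C2 j k) ^ 2) +
      16 * (kvLip γ C γc N ^ 2 * (((N + 1 : ℕ) : ℝ)⁻¹ * ∑ i : Fin (N + 1),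
        (if euclidDist (w i).1 x < kvRad γ γc N then (1 : ℝ) else 0) *
          ∫ x', wgtC N ψ w x' i * ‖(w i).2 - ubarC N ψ w x'‖ ^ 4)) +
      80 * (ethG N φ ψ w x * reyG N φ ψ w x) := by
  obtain ⟨hp, hpd⟩ := rank2_data j k
  have h := blkC_sq_le (C2 j k) hadm hadmc w x hp (F := fun y => ‖y‖) (G := fun d => ‖d‖) continuous_norm
    continuous_norm (fun y => norm_nonneg y) (fun d => norm_nonneg d)
    (fun y => by nlinarith [norm_nonneg y, sq_nonneg (‖y‖ ^ 2)]) (fun d => by nlinarith [sq_nonneg (‖d‖ ^ 2)]) hpd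
  simp only [Nat.reduceMul] at h
  exact h.trans (le_of_eq (by ring))

/-- Heat-flux entries: `q_a² ≤ 4 A_a + 4 ε² KV₆ + 180 ethG·reyG`. -/
theorem blkC3_sq_le (hadm : AdmissibleKernel γ C φ) (hadmc : AdmissibleKernel γc C' ψ) (w : Cfg N) (x : T3)
    (a : Fin 3) :
    blkC 3 N φ w x (C3 a) ^ 2 ≤ 4 * (∫ x', φ N (x' - x) * blkC 3 N ψ w x' (C3 a) ^ 2) +
      4 * (kvLip γ C γc N ^ 2 * (((N + 1 : ℕ) : ℝ)⁻¹ * ∑ i : Fin (N + 1),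
        (if euclidDist (w i).1 x < kvRad γ γc N then (1 : ℝ) else 0) *
          ∫ x', wgtC N ψ w x' i * ‖(w i).2 - ubarC N ψ w x'‖ ^ 6)) +
      180 * (ethG N φ ψ w x * reyG N φ ψ w x) := by
  obtain ⟨hp, hpd⟩ := rank3_data a
  have h := blkC_sq_le (C3 a) hadm hadmc w x hp (F := fun y => ‖y‖ ^ 2) (G := fun d => ‖d‖ ^ 2) (by fun_prop)
    (by fun_prop) (fun y => sq_nonneg ‖y‖) (fun d => sq_nonneg ‖d‖)
    (fun y => by nlinarith [norm_nonneg y, sq_nonneg ‖y‖]) (fun d => by nlinarith [sq_nonneg ‖d‖]) hpd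
  simp only [Nat.reduceMul] at h
  exact h.trans (le_of_eq (by ring))

/-- **THE POINTWISE GERMANO INEQUALITY** for the crux integrand over one block (every configuration, every
centre): `defectC φ ≤ 4 ∫ φ_N(x'−x) defectC ψ x' dx' + 144 ε_N² (KV₄ + KV₆) + 1260 ethG·reyG`. -/
theorem defectC_le_germano (hadm : AdmissibleKernel γ C φ) (hadmc : AdmissibleKernel γc C' ψ) (w : Cfg N)
    (x : T3) :
    defectC N φ w x ≤ 4 * (∫ x', φ N (x' - x) * defectC N ψ w x') +
      144 * (kvLip γ C γc N ^ 2 * (((N + 1 : ℕ) : ℝ)⁻¹ * ∑ i : Fin (N + 1),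
        (if euclidDist (w i).1 x < kvRad γ γc N then (1 : ℝ) else 0) *
          ∫ x', wgtC N ψ w x' i * ‖(w i).2 - ubarC N ψ w x'‖ ^ 4)) +
      144 * (kvLip γ C γc N ^ 2 * (((N + 1 : ℕ) : ℝ)⁻¹ * ∑ i : Fin (N + 1),
        (if euclidDist (w i).1 x < kvRad γ γc N then (1 : ℝ) else 0) *
          ∫ x', wgtC N ψ w x' i * ‖(w i).2 - ubarC N ψ w x'‖ ^ 6)) +
      1260 * (ethG N φ ψ w x * reyG N φ ψ w x) := by
  have hψc : Continuous (ψ N) := (hadmc.1 N).continuous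
  have hψ0 := hadmc.2.1 N
  have hkc : Continuous fun x' => φ N (x' - x) := (hadm.1 N).continuous.comp (continuous_id.sub continuous_const)
  have hI2 : ∀ j k, Integrable fun x' => φ N (x' - x) * blkC 2 N ψ w x' (C2 j k) ^ 2 := fun j k =>
    integrable_mul_blkC_sq hψc hψ0 w hkc (C2 j k)
  have hI3 : ∀ a, Integrable fun x' => φ N (x' - x) * blkC 3 N ψ w x' (C3 a) ^ 2 := fun a =>
    integrable_mul_blkC_sq hψc hψ0 w hkc (C3 a)
  have hconv : ∫ x', φ N (x' - x) * defectC N ψ w x' =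
      (∑ j, ∑ k, ∫ x', φ N (x' - x) * blkC 2 N ψ w x' (C2 j k) ^ 2) +
        ∑ a, ∫ x', φ N (x' - x) * blkC 3 N ψ w x' (C3 a) ^ 2 := by
    unfold defectC
    simp_rw [mul_add, Finset.mul_sum]
    rw [integral_add (integrable_finsetSum _ fun j _ => integrable_finsetSum _ fun k _ => hI2 j k)
      (integrable_finsetSum _ fun a _ => hI3 a),
      integral_finsetSum _ (fun j _ => integrable_finsetSum _ fun k _ => hI2 j k),
      integral_finsetSum _ (fun a _ => hI3 a)]
    congr 1
    exact Finset.sum_congr rfl fun j _ => integral_finsetSum _ fun k _ => hI2 j k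
  have h2 := fun j k => blkC2_sq_le hadm hadmc w x j k
  have h3 := fun a => blkC3_sq_le hadm hadmc w x a
  have hKV6 : 0 ≤ kvLip γ C γc N ^ 2 * (((N + 1 : ℕ) : ℝ)⁻¹ * ∑ i : Fin (N + 1),
      (if euclidDist (w i).1 x < kvRad γ γc N then (1 : ℝ) else 0) *
        ∫ x', wgtC N ψ w x' i * ‖(w i).2 - ubarC N ψ w x'‖ ^ 6) :=
    mul_nonneg (sq_nonneg _) (mul_nonneg (by positivity) (Finset.sum_nonneg fun i _ => mul_nonneg
      (by split_ifs <;> norm_num) (integral_nonneg fun x' => mul_nonneg (hψ0 _) (by positivity))))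
  rw [hconv]
  unfold defectC
  simp only [Fin.sum_univ_three] at *
  linarith [h2 0 0, h2 0 1, h2 0 2, h2 1 0, h2 1 1, h2 1 2, h2 2 0, h2 2 1, h2 2 2, h3 0, h3 1, h3 2]

end Pointwise

/-! ## Sup bounds over one block -/

section Bounds

variable {N : ℕ} {φ ψ : ℕ → T3 → ℝ} {V Cw : ℝ}

/-- Sup bounds of the block moments with velocities `|vᵢ| ≤ V` and weights `0 ≤ φᵢ ≤ Cw`. -/
theorem abs_blkC_le (hφ0 : ∀ y, 0 ≤ φ N y) (hφC : ∀ y, φ N y ≤ Cw) (w : Cfg N) (x : T3) (hV : 0 ≤ V)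
    (hv : ∀ i, ‖(w i).2‖ ≤ V) :
    (∀ j k, |blkC 2 N φ w x (C2 j k)| ≤ Cw * (2 * (2 * V) ^ 2)) ∧
      ∀ a, |blkC 3 N φ w x (C3 a)| ≤ Cw * (2 * V) ^ 3 := by
  have hCw : 0 ≤ Cw := (hφ0 0).trans (hφC 0)
  have hw : ∀ i, |wgtC N φ w x i| ≤ Cw := fun i => by
    rw [wgtC, abs_of_nonneg (hφ0 _)]
    exact hφC _
  have hu : ‖ubarC N φ w x‖ ≤ V := norm_ubarC_le hφ0 w hV hv x
  have ha : ∀ i, ‖(w i).2 - ubarC N φ w x‖ ≤ 2 * V := fun i =>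
    (norm_sub_le _ _).trans (by linarith [hv i])
  refine ⟨fun j k => ?_, fun a => ?_⟩
  · exact ScaleSplit.abs_avg_wmul_le hCw hw fun i =>
      (Pointwise.abs_pairT_C2_le j k _).trans (by nlinarith [ha i, norm_nonneg ((w i).2 - ubarC N φ w x)])
  · exact ScaleSplit.abs_avg_wmul_le hCw hw fun i =>
      (Pointwise.abs_pairT_C3_le a _).trans (pow_le_pow_left₀ (norm_nonneg _) (ha i) 3)

/-- Sup bound of the crux integrand over one block. -/
theorem defectC_le_of_vel (hφ0 : ∀ y, 0 ≤ φ N y) (hφC : ∀ y, φ N y ≤ Cw) (w : Cfg N) (x : T3) (hV : 0 ≤ V)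
    (hv : ∀ i, ‖(w i).2‖ ≤ V) :
    |defectC N φ w x| ≤ 9 * (Cw * (2 * (2 * V) ^ 2)) ^ 2 + 3 * (Cw * (2 * V) ^ 3) ^ 2 := by
  obtain ⟨h2, h3⟩ := abs_blkC_le hφ0 hφC w x hV hv
  have h2' : ∀ j k, blkC 2 N φ w x (C2 j k) ^ 2 ≤ (Cw * (2 * (2 * V) ^ 2)) ^ 2 := fun j k => by
    rw [← sq_abs]; exact pow_le_pow_left₀ (abs_nonneg _) (h2 j k) 2
  have h3' : ∀ a, blkC 3 N φ w x (C3 a) ^ 2 ≤ (Cw * (2 * V) ^ 3) ^ 2 := fun a => by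
    rw [← sq_abs]; exact pow_le_pow_left₀ (abs_nonneg _) (h3 a) 2
  rw [abs_of_nonneg (by unfold defectC; positivity)]
  unfold defectC
  simp only [Fin.sum_univ_three]
  linarith [h2' 0 0, h2' 0 1, h2' 0 2, h2' 1 0, h2' 1 1, h2' 1 2, h2' 2 0, h2' 2 1, h2' 2 2, h3' 0, h3' 1, h3' 2]

/-- A block average of unit-mass cell smearings of a bounded nonnegative quantity is bounded:
`0 ≤ ∫ (N+1)⁻¹ Σᵢ aᵢ bᵢ(x') Kᵢ(x') dx' ≤ Cw · B` when `0 ≤ Kᵢ ≤ B`, `0 ≤ aᵢ ≤ Cw`, `∫ bᵢ = 1`. -/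
theorem integral_avg_le (hψc : Continuous (ψ N)) (hψ0 : ∀ y, 0 ≤ ψ N y) (hψ1 : ∫ y, ψ N y = 1)
    (hφ0 : ∀ y, 0 ≤ φ N y) (hφC : ∀ y, φ N y ≤ Cw) (w : Cfg N) (x : T3)
    {K : Fin (N + 1) → T3 → V3 → ℝ} (hK : ∀ i, Continuous (Function.uncurry (K i))) {B : ℝ}
    (hK0 : ∀ i x', 0 ≤ K i x' (ubarC N ψ w x')) (hKB : ∀ i x', K i x' (ubarC N ψ w x') ≤ B) :
    0 ≤ ∫ x', ((N + 1 : ℕ) : ℝ)⁻¹ * ∑ i : Fin (N + 1),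
        wgtC N φ w x i * (wgtC N ψ w x' i * K i x' (ubarC N ψ w x')) ∧
      ∫ x', ((N + 1 : ℕ) : ℝ)⁻¹ * ∑ i : Fin (N + 1),
        wgtC N φ w x i * (wgtC N ψ w x' i * K i x' (ubarC N ψ w x')) ≤ Cw * B := by
  have hn : (0 : ℝ) ≤ ((N + 1 : ℕ) : ℝ)⁻¹ := by positivity
  have hB : 0 ≤ B := (hK0 0 x).trans (hKB 0 x)
  have hI := integrable_avg hψc hψ0 w (wgtC N φ w x) hK
  have hIb : ∀ i, Integrable fun x' => wgtC N ψ w x' i :=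
    fun i => PastDamping.integrable_of_continuous_T3 (hψc.comp (continuous_const.sub continuous_id))
  have hI' : Integrable fun x' => ((N + 1 : ℕ) : ℝ)⁻¹ * ∑ i : Fin (N + 1), (Cw * B) * wgtC N ψ w x' i :=
    (integrable_finsetSum _ fun i _ => (hIb i).const_mul _).const_mul _
  refine ⟨integral_nonneg fun x' => mul_nonneg hn (Finset.sum_nonneg fun i _ =>
    mul_nonneg (hφ0 _) (mul_nonneg (hψ0 _) (hK0 i x'))), ?_⟩
  calc _ ≤ ∫ x', ((N + 1 : ℕ) : ℝ)⁻¹ * ∑ i : Fin (N + 1), (Cw * B) * wgtC N ψ w x' i := by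
        refine integral_mono hI hI' fun x' => mul_le_mul_of_nonneg_left (Finset.sum_le_sum fun i _ => ?_) hn
        calc wgtC N φ w x i * (wgtC N ψ w x' i * K i x' (ubarC N ψ w x'))
            = (wgtC N φ w x i * K i x' (ubarC N ψ w x')) * wgtC N ψ w x' i := by ring
          _ ≤ (Cw * B) * wgtC N ψ w x' i :=
            mul_le_mul_of_nonneg_right (mul_le_mul (hφC _) (hKB i x') (hK0 i x') ((hφ0 0).trans (hφC 0)))
              (hψ0 _)
    _ = Cw * B := by
        rw [integral_const_mul, integral_finsetSum _ fun i _ => (hIb i).const_mul _]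
        simp only [integral_const_mul, integral_wgtC_right hψ1 w, mul_one, Finset.sum_const, Finset.card_univ,
          Fintype.card_fin, nsmul_eq_mul]
        field_simp

/-- Sup bound of `ethG` over one block: `0 ≤ ethG ≤ Cw (1 + (2V)² + (2V)⁴ + (2V)²)`. -/
theorem ethG_le_of_vel (hψc : Continuous (ψ N)) (hψ0 : ∀ y, 0 ≤ ψ N y) (hψ1 : ∫ y, ψ N y = 1)
    (hφ0 : ∀ y, 0 ≤ φ N y) (hφC : ∀ y, φ N y ≤ Cw) (w : Cfg N) (x : T3) (hV : 0 ≤ V)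
    (hv : ∀ i, ‖(w i).2‖ ≤ V) :
    0 ≤ ethG N φ ψ w x ∧ ethG N φ ψ w x ≤ Cw * (1 + (2 * V) ^ 2 + (2 * V) ^ 4 + (2 * V) ^ 2) := by
  have hc : ∀ x', ‖ubarC N ψ w x'‖ ≤ V := norm_ubarC_le hψ0 w hV hv
  have hu : ‖ubarC N φ w x‖ ≤ V := norm_ubarC_le hφ0 w hV hv x
  have ha : ∀ i x', ‖(w i).2 - ubarC N ψ w x'‖ ≤ 2 * V := fun i x' =>
    (norm_sub_le _ _).trans (by linarith [hv i, hc x'])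
  have hd : ∀ x', ‖ubarC N ψ w x' - ubarC N φ w x‖ ≤ 2 * V := fun x' =>
    (norm_sub_le _ _).trans (by linarith [hu, hc x'])
  refine integral_avg_le hψc hψ0 hψ1 hφ0 hφC w x
    (K := fun i _ z => 1 + ‖(w i).2 - z‖ ^ 2 + ‖(w i).2 - z‖ ^ 4 + ‖z - ubarC N φ w x‖ ^ 2)
    (fun i => by fun_prop) (fun i x' => by positivity) fun i x' => ?_
  have h2 := pow_le_pow_left₀ (norm_nonneg _) (ha i x') 2
  have h4 := pow_le_pow_left₀ (norm_nonneg _) (ha i x') 4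
  have hd2 := pow_le_pow_left₀ (norm_nonneg _) (hd x') 2
  change 1 + _ + _ + _ ≤ _
  linarith

/-- Sup bound of `reyG` over one block: `0 ≤ reyG ≤ Cw ((2V)² + (2V)⁴)`. -/
theorem reyG_le_of_vel (hψc : Continuous (ψ N)) (hψ0 : ∀ y, 0 ≤ ψ N y) (hψ1 : ∫ y, ψ N y = 1)
    (hφ0 : ∀ y, 0 ≤ φ N y) (hφC : ∀ y, φ N y ≤ Cw) (w : Cfg N) (x : T3) (hV : 0 ≤ V)
    (hv : ∀ i, ‖(w i).2‖ ≤ V) :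
    0 ≤ reyG N φ ψ w x ∧ reyG N φ ψ w x ≤ Cw * ((2 * V) ^ 2 + (2 * V) ^ 4) := by
  have hc : ∀ x', ‖ubarC N ψ w x'‖ ≤ V := norm_ubarC_le hψ0 w hV hv
  have hu : ‖ubarC N φ w x‖ ≤ V := norm_ubarC_le hφ0 w hV hv x
  have hd : ∀ x', ‖ubarC N ψ w x' - ubarC N φ w x‖ ≤ 2 * V := fun x' =>
    (norm_sub_le _ _).trans (by linarith [hu, hc x'])
  refine integral_avg_le hψc hψ0 hψ1 hφ0 hφC w x
    (K := fun _ _ z => ‖z - ubarC N φ w x‖ ^ 2 + ‖z - ubarC N φ w x‖ ^ 4)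
    (fun i => by fun_prop) (fun i x' => by positivity) fun i x' => ?_
  have hd2 := pow_le_pow_left₀ (norm_nonneg _) (hd x') 2
  have hd4 := pow_le_pow_left₀ (norm_nonneg _) (hd x') 4
  change _ + _ ≤ _
  linarith

end Bounds

end Coarsening

/-- Registered anchor of this helper file (`--supports stmt-AtomisticToContinuum-14868`): THE POINTWISE GERMANO
INEQUALITY for the crux integrand over one block (`Coarsening.defectC_le_germano`). -/
theorem bhCoarsening_germano_anchor : ∀ (N : ℕ) (γ C γc C' : ℝ) (φ ψ : ℕ → T3 → ℝ) (w : Cfg N) (x : T3), AdmissibleKernel γ C φ → AdmissibleKernel γc C' ψ → defectC N φ w x ≤ 4 * (∫ x', φ N (x' - x) * defectC N ψ w x') + 144 * (Coarsening.kvLip γ C γc N ^ 2 * (((N + 1 : ℕ) : ℝ)⁻¹ * ∑ i : Fin (N + 1), (if euclidDist (w i).1 x < Coarsening.kvRad γ γc N then (1 : ℝ) else 0) * ∫ x', wgtC N ψ w x' i * ‖(w i).2 - ubarC N ψ w x'‖ ^ 4)) + 144 * (Coarsening.kvLip γ C γc N ^ 2 * (((N + 1 : ℕ) : ℝ)⁻¹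 * ∑ i : Fin (N + 1), (if euclidDist (w i).1 x < Coarsening.kvRad γ γc N then (1 : ℝ) else 0) * ∫ x', wgtC N ψ w x' i * ‖(w i).2 - ubarC N ψ w x'‖ ^ 6)) + 1260 * (ethG N φ ψ w x * reyG N φ ψ w x) :=
  fun _ _ _ _ _ _ _ w x hadm hadmc => Coarsening.defectC_le_germano hadm hadmc w x

end

end Summit.AtomisticToContinuum.HydrodynamicLimit.Theorems.BlockHDissipation
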